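import Summits.KontsevichZagierPeriods.KontsevichZagierPeriods.Theorems.BetaCancellation.Negative.LoadBearing
import Literature.NumberTheory.Transcendental.KZSubcalculusInvariants

/-!
# `BetaCancellation` (stmt-KontsevichZagierPeriods-13633) — torsion is not an escape

cdisprove (refuter, gen 2) file for crux #4 `BetaCancellation` of route TerasomaMultiplication
(namespace `…BetaCancellationNegative`, companions `Negative/KernelForm.lean`, `Negative/LoadBearing.lean`).
Sorry-free, axioms ⊆ {propext, Classical.choice, Quot.sound}.

`KZ.FormalRep ⧸ KZ.relations` is TORSION-FREE and DIVISIBLE (a `ℚ`-vector space) by proved facts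
only: `k • x ≡ scale k x (mod relations)` (`nsmul_sub_scale_mem_relations`, from
`KZ.IntegralRep.of_constMul_nat_sub_nsmul_mem_relations`) and `KZ.scale c` (`c ≠ 0` real algebraic)
is invertible and preserves relations (`scale_inv_scale`, `scale_mem_relations_iff`). Hence
`nsmul_mem_relations_iff`, `zsmul_mem_relations_iff`, `equivalent_of_nsmul_sub_mem`
(`k • ([r] − [r']) ∈ relations → r ∼ r'` — moots the failure mode "only `N·([r]−[r'])` may be a
relation" of cruxes MultiplicationThree / MultiplicationAccessible), `exists_nsmul_sub_mem_relations`,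
and the scalar cancellation `equivalent_of_equivalent_constMul`. (Gen 1's briefing spoke of an
"open torsion-freeness"; it is a theorem.)
-/

noncomputable section

set_option linter.dupNamespace false

namespace Summit.KontsevichZagierPeriods.KontsevichZagierPeriods.BetaCancellationNegative

open MeasureTheory Set
open Literature.NumberTheory.Transcendental
open Literature.NumberTheory.Transcendental.KZ
open Literature.ModelTheory.ExponentialFields (IsSemialgebraic isSemialgebraic_univ)
open MvPolynomial (aeval X C)
open Summit.KontsevichZagierPeriods.KontsevichZagierPeriods.Theses.TerasomaMultiplication
  (BetaCancellation)
open Literature.NumberTheory.Transcendental.KZreg (unitIoo isSemialgebraic_unitIoo volume_unitIoo)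

/-! ## §11 TORSION IS NOT AN ESCAPE: `FormalRep ⧸ relations` is torsion-free (and divisible) -/

/-- Scaling by `k` and then by `k⁻¹` is the identity on representations (`k ≠ 0`). [folklore] -/
theorem constMul_inv_constMul {n : ℕ} (r : IntegralRep n) {c : ℝ} (hc : IsAlgebraic ℚ c)
    (hc0 : c ≠ 0) : (r.constMul c hc).constMul c⁻¹ hc.inv = r := by
  refine IntegralRep.ext' rfl ?_
  funext x
  simp only [IntegralRep.integrand_constMul]
  rw [← mul_assoc, inv_mul_cancel₀ hc0, one_mul]

/-- Scaling by `k⁻¹` and then by `k` is the identity on representations (`k ≠ 0`). [folklore] -/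
theorem constMul_constMul_inv {n : ℕ} (r : IntegralRep n) {c : ℝ} (hc : IsAlgebraic ℚ c)
    (hc0 : c ≠ 0) : (r.constMul c⁻¹ hc.inv).constMul c hc = r := by
  refine IntegralRep.ext' rfl ?_
  funext x
  simp only [IntegralRep.integrand_constMul]
  rw [← mul_assoc, mul_inv_cancel₀ hc0, one_mul]

/-- `scale c⁻¹ ∘ scale c = id` on `FormalRep` (`c ≠ 0` real algebraic). [folklore] -/
theorem scale_inv_scale {c : ℝ} (hc : IsAlgebraic ℚ c) (hc0 : c ≠ 0) (x : FormalRep) :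
    scale c⁻¹ hc.inv (scale c hc x) = x := by
  induction x using FreeAbelianGroup.induction_on with
  | zero => simp
  | of s =>
    obtain ⟨n, r⟩ := s
    show scale c⁻¹ hc.inv (scale c hc (of r)) = of r
    rw [scale_of, scale_of, constMul_inv_constMul r hc hc0]
  | neg s ih =>
    obtain ⟨n, r⟩ := s
    show scale c⁻¹ hc.inv (scale c hc (-of r)) = -of r
    rw [map_neg, map_neg, scale_of, scale_of, constMul_inv_constMul r hc hc0]
  | add x y hx hy => rw [map_add, map_add, hx, hy]

/-- `scale c ∘ scale c⁻¹ = id` on `FormalRep` (`c ≠ 0` real algebraic). [folklore] -/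
theorem scale_scale_inv {c : ℝ} (hc : IsAlgebraic ℚ c) (hc0 : c ≠ 0) (x : FormalRep) :
    scale c hc (scale c⁻¹ hc.inv x) = x := by
  induction x using FreeAbelianGroup.induction_on with
  | zero => simp
  | of s =>
    obtain ⟨n, r⟩ := s
    show scale c hc (scale c⁻¹ hc.inv (of r)) = of r
    rw [scale_of, scale_of, constMul_constMul_inv r hc hc0]
  | neg s ih =>
    obtain ⟨n, r⟩ := s
    show scale c hc (scale c⁻¹ hc.inv (-of r)) = -of r
    rw [map_neg, map_neg, scale_of, scale_of, constMul_constMul_inv r hc hc0]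
  | add x y hx hy => rw [map_add, map_add, hx, hy]

/-- **Cancelling a non-zero algebraic scalar from a relation**: `scale c x ∈ relations ↔
x ∈ relations`. [folklore] -/
theorem scale_mem_relations_iff {c : ℝ} (hc : IsAlgebraic ℚ c) (hc0 : c ≠ 0) (x : FormalRep) :
    scale c hc x ∈ relations ↔ x ∈ relations := by
  refine ⟨fun h => ?_, scale_mem_relations c hc⟩
  have h' := scale_mem_relations c⁻¹ hc.inv h
  rwa [scale_inv_scale hc hc0] at h'

/-- **Cancelling a non-zero algebraic scalar from an equivalence.** [folklore] -/
theorem equivalent_of_equivalent_constMul {n m : ℕ} {r : IntegralRep n} {r' : IntegralRep m}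
    {c : ℝ} (hc : IsAlgebraic ℚ c) (hc0 : c ≠ 0)
    (h : Equivalent (r.constMul c hc) (r'.constMul c hc)) : Equivalent r r' := by
  have h' := h.constMul c⁻¹ hc.inv
  rwa [constMul_inv_constMul r hc hc0, constMul_inv_constMul r' hc hc0] at h'

/-- **Integer multiples are scalings modulo relations**: `k • x − scale k x ∈ relations`
(integrand additivity, `KZ.IntegralRep.of_constMul_nat_sub_nsmul_mem_relations`, extended
additively). [folklore] -/
theorem nsmul_sub_scale_mem_relations (k : ℕ) (x : FormalRep) :
    k • x - scale (k : ℝ) (isAlgebraic_nat k) x ∈ relations := by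
  induction x using FreeAbelianGroup.induction_on with
  | zero => simp [relations.zero_mem]
  | of s =>
    obtain ⟨n, r⟩ := s
    show k • of r - scale (k : ℝ) (isAlgebraic_nat k) (of r) ∈ relations
    rw [scale_of, ← neg_sub]
    exact relations.neg_mem (r.of_constMul_nat_sub_nsmul_mem_relations k)
  | neg s ih =>
    obtain ⟨n, r⟩ := s
    have h0 : k • of r - scale (k : ℝ) (isAlgebraic_nat k) (of r) ∈ relations := by
      rw [scale_of, ← neg_sub]
      exact relations.neg_mem (r.of_constMul_nat_sub_nsmul_mem_relations k)
    have : k • (-of r) - scale (k : ℝ) (isAlgebraic_nat k) (-of r) =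
        -(k • of r - scale (k : ℝ) (isAlgebraic_nat k) (of r)) := by
      rw [smul_neg, map_neg]; abel
    show k • (-of r) - scale (k : ℝ) (isAlgebraic_nat k) (-of r) ∈ relations
    rw [this]
    exact relations.neg_mem h0
  | add x y hx hy =>
    have : k • (x + y) - scale (k : ℝ) (isAlgebraic_nat k) (x + y) =
        (k • x - scale (k : ℝ) (isAlgebraic_nat k) x) + (k • y - scale (k : ℝ) (isAlgebraic_nat k) y) := by
      rw [smul_add, map_add]; abel
    rw [this]
    exact relations.add_mem hx hy

/-- **TORSION-FREENESS of the formal effective period group `FormalRep ⧸ relations`**: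
`k • x ∈ relations → x ∈ relations` for every `k ≠ 0` — "division by a positive integer IS a
derived rule" of the calculus (`k • x ≡ scale k x`, and `scale k⁻¹` preserves relations). So no
"only `N · ([r] − [r'])` is a relation" obstruction can exist anywhere in this calculus.
[folklore] -/
theorem mem_relations_of_nsmul_mem {k : ℕ} (hk : k ≠ 0) {x : FormalRep}
    (h : k • x ∈ relations) : x ∈ relations := by
  have hk' : (k : ℝ) ≠ 0 := by exact_mod_cast hk
  have h1 : scale (k : ℝ) (isAlgebraic_nat k) x ∈ relations := by
    have := relations.sub_mem h (nsmul_sub_scale_mem_relations k x)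
    rwa [sub_sub_cancel] at this
  exact (scale_mem_relations_iff (isAlgebraic_nat k) hk' x).1 h1

/-- Torsion-freeness, `iff` form. [folklore] -/
theorem nsmul_mem_relations_iff {k : ℕ} (hk : k ≠ 0) (x : FormalRep) :
    k • x ∈ relations ↔ x ∈ relations :=
  ⟨mem_relations_of_nsmul_mem hk, fun h => relations.nsmul_mem h k⟩

/-- Torsion-freeness for integer multiples. [folklore] -/
theorem zsmul_mem_relations_iff {k : ℤ} (hk : k ≠ 0) (x : FormalRep) :
    k • x ∈ relations ↔ x ∈ relations := by
  rcases Int.natAbs_eq k with hk' | hk'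
  · rw [hk', natCast_zsmul]
    exact nsmul_mem_relations_iff (by omega) x
  · rw [hk', neg_smul, natCast_zsmul, neg_mem_iff]
    exact nsmul_mem_relations_iff (by omega) x

/-- **Two-term form**: `k • ([r] − [r']) ∈ relations → r ∼ r'` (`k ≠ 0`). This moots the failure
mode "only `N·([r]−[r'])` may be a relation" recorded for cruxes `MultiplicationThree` /
`MultiplicationAccessible` of the route. [folklore] -/
theorem equivalent_of_nsmul_sub_mem {n m : ℕ} {k : ℕ} (hk : k ≠ 0) {r : IntegralRep n}
    {r' : IntegralRep m} (h : k • (of r - of r') ∈ relations) : Equivalent r r' :=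
  mem_relations_of_nsmul_mem hk h

/-- **DIVISIBILITY**: every class is a `k`-th multiple modulo relations (`x ≡ k • scale k⁻¹ x`).
With torsion-freeness, `FormalRep ⧸ relations` is uniquely divisible — a `ℚ`-vector space.
[folklore] -/
theorem exists_nsmul_sub_mem_relations {k : ℕ} (hk : k ≠ 0) (x : FormalRep) :
    ∃ y : FormalRep, x - k • y ∈ relations := by
  have hk' : (k : ℝ) ≠ 0 := by exact_mod_cast hk
  refine ⟨scale (k : ℝ)⁻¹ (isAlgebraic_nat k).inv x, ?_⟩
  have h1 := nsmul_sub_scale_mem_relations k (scale (k : ℝ)⁻¹ (isAlgebraic_nat k).inv x)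
  rw [scale_scale_inv (isAlgebraic_nat k) hk'] at h1
  have : x - k • scale (k : ℝ)⁻¹ (isAlgebraic_nat k).inv x =
      -(k • scale (k : ℝ)⁻¹ (isAlgebraic_nat k).inv x - x) := by abel
  rw [this]
  exact relations.neg_mem h1



end Summit.KontsevichZagierPeriods.KontsevichZagierPeriods.BetaCancellationNegative
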